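import Summits.CriticalPhenomena.PercolationContinuityZ3.Theorems.Transplant.FKConnectivityAllQForestTreeLevelPairCell
import HarnessLib

/-!
# CONJECTURE H1′ (the two-cell bound, NOT asserted) and the level-free elimination steps it drives

Support file (`--supports stmt-CriticalPhenomena-4575`), FK sub-lane `prim-bschramm-fk-1` (generation 30) of the post-continuity
programme; builds on p205010 (kernel theorem, internal audit signed; external expert review pending).  One counting node (NOT asserted),
three theorems; no named facts, no sorries; standard axioms.

VERTEX ELIMINATION (g23 `fibreCount_forest_claw_decomp`, g29 `fibreCount_forest_degTwo_decomp`): for the node (♣)⁰ =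
`AdjForestRayleighNoSqOn` at the hub `o` (`e = ov`, `f = oy`) and a vertex `z ∉ {o, v, y}` carrying exactly the free pairs `za, zb, zc`
of a fibre `(M′ ∪ {za, zb, zc}, u₀)`, `bad` and `good` split into three PAIR CELLS (one class separates two of `a, b, c`; each is a node
instance on a fibre over the rest `(M′, u₀)` ± one pair: **`pairCell_le`**, the level-free form of g29's `treeLevel_pairCell_le`) and the
CLAW CELL (one class separates `a, b, c` pairwise).  At the tight level the claw cell vanishes (g29); in general it does NOT and it can be
NEGATIVE even for `z` far from `o, v, y` (memo bschramm/FROM-fk-1-g30-LAMAN-IDENTITIES.md §0 item 4: n = 10–14, also inside the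
3-connected Laman universe).

**CONJECTURE H1′ = `TwoCellBoundOn V` (memo §4):** if `o ∉ {a, b, c}` (the eliminated vertex is NOT adjacent to the hub), then for SOME
labelling the claw cell is dominated by ONE pair cell: `claw_bad + cell_bad ≤ claw_good + cell_good` — equivalently `margin ≥` the sum of
the two smallest pair cells, equivalently "conditioned on two of the three pairs at `z` receiving the same colour, `e, f` are weakly
negatively correlated".  EVIDENCE (exact, numerics/jcensus/hcensus*.c = g18's orderly generator + a new leaf statistic): EXHAUSTIVE over
all connected simple graphs with n ≤ 9 vertices at EVERY level `n+1 ≤ m ≤ 2n−3` (1,976,057 cells `(o,e,f,z)` at n = 9, 15,541 of them with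
a negative claw cell) and n = 10 at the Laman level (22,083,402 cells): 0 failures; random 3-connected Laman graphs n ≤ 15 and random
multigraphs n ≤ 11: 0 failures; g19's margin-2 family `W(k;t)`: holds with cells `(0,0,2)`.  FALSE when `z` is adjacent to `o`.
CONSEQUENCE (memo §4; kernel assembly = successor): since every other step of the elimination is level-free — far vertices of weighted
degree ≤ 2 (here: **`twoCellBound_step_degTwo`**, no hypothesis), mixed/pendant vertices (g29), `o`/`v`/`y` of weighted degree ≤ 2
(g30 `T/ForestToggleE`), and the counting lemma "a fibre below the tree level with all weighted degrees ≥ 3 has a weighted-degree-3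
vertex not joined to `o`" — `TwoCellBoundOn V` implies `AdjForestRayleighNoSqOn V` by induction on the support; this file provides the
degree-3 step **`twoCellBound_step_claw`**.
[cite: CibulkaHladkyLaCroixWagner2008, Thm. 1 (p. 2), Case 3, Table 1 (p. 5)] [cite: SempleWelsh2008, Conj. 1.1 (p. 2); Thm. 4.2 (p. 11)]
[cite: Linusson2011, Prop. 2.6] [cite: Grimmett2006, §1.5 (p. 13)]
-/

noncomputable section

namespace Summit.CriticalPhenomena.PercolationContinuityZ3.Theorems
namespace FK

open MeasureTheory Set Literature.Probability.LatticeModels Literature.Probability.Percolation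
open scoped Classical symmDiff

variable {V : Type*} [Fintype V]

/-! ### The node -/

/-- The separation event "no two of `a, b, c` are joined" (the claw-cell event of g23's decomposition). [cite: Grimmett2006, §1.5 (p. 13)] -/
def sep₃Ev (a b c : V) : Set (BondConfig V) :=
  {ω | ¬ (openGraph ω).Reachable a b ∧ ¬ (openGraph ω).Reachable a c ∧ ¬ (openGraph ω).Reachable b c}

/-- The separation event "`p` and `q` are not joined" (the pair-cell event). [cite: Grimmett2006, §1.5 (p. 13)] -/
def sep₂Ev (p q : V) : Set (BondConfig V) := {ω | ¬ (openGraph ω).Reachable p q}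

/-- **One instance of the two-cell inequality** on the rest fibre `(M′, u₀)`: the claw cell of `(a, b, c)` plus the pair cell of `(p, q)`,
`bad` side, is at most the same combination on the `good` side (`e = ov`, `f = oy`). [cite: Linusson2011, Prop. 2.6] -/
def TwoCellIneq (M' u₀ : BondConfig V) (o v y a b c p q : V) : Prop :=
  fibreCount M' u₀ (forestEv V ∩ sep₃Ev a b c ∩ {ω | s(o, v) ∈ ω ∧ s(o, y) ∈ ω}) (forestEv V ∩ univ) +
      fibreCount M' u₀ (forestEv V ∩ {ω | s(o, v) ∈ ω ∧ s(o, y) ∈ ω}) (forestEv V ∩ sep₃Ev a b c ∩ univ) +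
    (fibreCount M' u₀ (forestEv V ∩ sep₂Ev p q ∩ {ω | s(o, v) ∈ ω ∧ s(o, y) ∈ ω}) (forestEv V ∩ univ) +
      fibreCount M' u₀ (forestEv V ∩ {ω | s(o, v) ∈ ω ∧ s(o, y) ∈ ω}) (forestEv V ∩ sep₂Ev p q ∩ univ)) ≤
  fibreCount M' u₀ (forestEv V ∩ sep₃Ev a b c ∩ {ω | s(o, v) ∈ ω}) (forestEv V ∩ {ω | s(o, y) ∈ ω}) +
      fibreCount M' u₀ (forestEv V ∩ {ω | s(o, v) ∈ ω}) (forestEv V ∩ sep₃Ev a b c ∩ {ω | s(o, y) ∈ ω}) +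
    (fibreCount M' u₀ (forestEv V ∩ sep₂Ev p q ∩ {ω | s(o, v) ∈ ω}) (forestEv V ∩ {ω | s(o, y) ∈ ω}) +
      fibreCount M' u₀ (forestEv V ∩ {ω | s(o, v) ∈ ω}) (forestEv V ∩ sep₂Ev p q ∩ {ω | s(o, y) ∈ ω}))

/-- **CONJECTURE H1′ — the TWO-CELL BOUND on the vertex type `V`** (NOT asserted): for every rest fibre `(M′, u₀)` (`Disjoint u₀ M′`),
every hub `o` with `e = ov, f = oy ∈ M′` (`v ≠ y`) and every vertex `z` outside all pairs of `M′ ∪ u₀`, `z ∉ {o, v, y}`, with three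
distinct prospective neighbours `a, b, c ≠ z`, NONE OF THEM EQUAL TO `o`: the claw cell of the elimination of `z` from
`(M′ ∪ {za, zb, zc}, u₀)` is dominated by one of the three pair cells (`TwoCellIneq` for the pair `bc`, `ac` or `ab`).
Evidence in the module docstring; false without `o ∉ {a, b, c}`.
[cite: SempleWelsh2008, Conj. 1.1 (p. 2)] [cite: CibulkaHladkyLaCroixWagner2008, Case 3, Table 1 (p. 5)] [cite: Linusson2011, Prop. 2.6] -/
def TwoCellBoundOn (V : Type*) [Fintype V] : Prop :=
  ∀ (M' u₀ : BondConfig V) (o v y z a b c : V), Disjoint u₀ M' → v ≠ y → s(o, v) ∈ M' → s(o, y) ∈ M' →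
    (∀ g ∈ M' ∪ u₀, z ∉ g) → z ≠ o → z ≠ v → z ≠ y → z ≠ a → z ≠ b → z ≠ c → a ≠ b → a ≠ c → b ≠ c →
    o ≠ a → o ≠ b → o ≠ c →
    TwoCellIneq M' u₀ o v y a b c b c ∨ TwoCellIneq M' u₀ o v y a b c a c ∨ TwoCellIneq M' u₀ o v y a b c a b

/-- **H1′ on every finite vertex type.**  CONJECTURE-SHAPED, NOT asserted. [cite: SempleWelsh2008, Conj. 1.1 (p. 2)] -/
@[conjecture] def TwoCellBoundPos : Prop := ∀ n : ℕ, TwoCellBoundOn (Fin n)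

/-! ### Pair cells, level-free -/

section PairCell

variable {M' u₀ : BondConfig V} {T : Finset V} {o v y p q : V}

/-- **Pair cells, level-free** (g29's `treeLevel_pairCell_le` without the tightness arithmetic): given the node's inequality on EVERY
fibre inside `T`, for `p ≠ q` in `T` the two cells "one class separates `p, q`" of `bad` on the rest `(M′, u₀)` (inside `T`, `e, f ∈ M′`)
are at most those of `good`: `pq` pinned ⇒ empty; `pq ∉ M′ ∪ u₀` ⇒ the cells add up to the fibre `(M′ ∪ {pq}, u₀)`; `pq ∈ M′` ⇒ each cell
is the pinned fibre `(M′ ∖ {pq}, u₀ ∪ {pq})` (for `pq ∈ {e, f}` the cells coincide).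
[cite: CibulkaHladkyLaCroixWagner2008, Case 3, Table 1 (p. 5)] [cite: Linusson2011, Prop. 2.6] -/
theorem pairCell_le
    (IH : ∀ (N u : BondConfig V), Disjoint u N → (∀ g ∈ N ∪ u, ∀ w ∈ g, w ∈ T) →
      fibreCount N u (forestEv V ∩ {ω | s(o, v) ∈ ω ∧ s(o, y) ∈ ω}) (forestEv V) ≤
        fibreCount N u (forestEv V ∩ {ω | s(o, v) ∈ ω}) (forestEv V ∩ {ω | s(o, y) ∈ ω}))
    (hd : Disjoint u₀ M') (hT : ∀ g ∈ M' ∪ u₀, ∀ w ∈ g, w ∈ T)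
    (he : s(o, v) ∈ M') (hf : s(o, y) ∈ M') (hvy : v ≠ y) (hp : p ∈ T) (hq : q ∈ T) (hpq : p ≠ q) :
    fibreCount M' u₀ (forestEv V ∩ {ω | ¬ (openGraph ω).Reachable p q} ∩ {ω | s(o, v) ∈ ω ∧ s(o, y) ∈ ω}) (forestEv V ∩ univ) +
        fibreCount M' u₀ (forestEv V ∩ {ω | s(o, v) ∈ ω ∧ s(o, y) ∈ ω}) (forestEv V ∩ {ω | ¬ (openGraph ω).Reachable p q} ∩ univ) ≤
      fibreCount M' u₀ (forestEv V ∩ {ω | ¬ (openGraph ω).Reachable p q} ∩ {ω | s(o, v) ∈ ω}) (forestEv V ∩ {ω | s(o, y) ∈ ω}) +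
        fibreCount M' u₀ (forestEv V ∩ {ω | s(o, v) ∈ ω}) (forestEv V ∩ {ω | ¬ (openGraph ω).Reachable p q} ∩ {ω | s(o, y) ∈ ω}) := by
  have hef : s(o, v) ≠ s(o, y) := fun h' => hvy (Sym2.congr_right.1 h')
  by_cases hgu : s(p, q) ∈ u₀
  · rw [fibreCount_forest_sep_eq_zero_of_mem_pinned hpq hgu, fibreCount_forest_sep_eq_zero_of_mem_pinned' hpq hgu]
    exact Nat.zero_le _
  by_cases hgM : s(p, q) ∈ M'
  · obtain ⟨M'', hgM'', rfl⟩ : ∃ M'', s(p, q) ∉ M'' ∧ M' = insert s(p, q) M'' :=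
      ⟨M' \ {s(p, q)}, by simp, by rw [insert_sdiff_singleton, insert_eq_of_mem hgM]⟩
    have hd' : Disjoint (insert s(p, q) u₀) M'' := by
      rw [Set.disjoint_insert_left]
      exact ⟨hgM'', Disjoint.mono_right (subset_insert _ _) hd⟩
    have hT' : ∀ g ∈ M'' ∪ insert s(p, q) u₀, ∀ w ∈ g, w ∈ T := by
      intro g hg w hw
      rcases hg with hg | hg
      · exact hT g (Or.inl (mem_insert_of_mem _ hg)) w hw
      · rcases mem_insert_iff.1 hg with rfl | hg
        · exact hT _ (Or.inl (mem_insert _ _)) w hw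
        · exact hT g (Or.inr hg) w hw
    by_cases hge : s(p, q) = s(o, v)
    · have hreach : ∀ {ω : BondConfig V}, s(o, v) ∈ ω → (openGraph ω).Reachable p q := fun {ω} h =>
        ((openGraph_adj _ _ _).2 ⟨hge ▸ h, hpq⟩).reachable
      have z1 : fibreCount (insert s(p, q) M'') u₀
          (forestEv V ∩ {ω | ¬ (openGraph ω).Reachable p q} ∩ {ω | s(o, v) ∈ ω ∧ s(o, y) ∈ ω}) (forestEv V ∩ univ) = 0 :=
        fibreCount_eq_zero_of_forall _ _ _ _ fun ω _ hA _ => hA.1.2 (hreach hA.2.1)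
      have z2 : fibreCount (insert s(p, q) M'') u₀
          (forestEv V ∩ {ω | ¬ (openGraph ω).Reachable p q} ∩ {ω | s(o, v) ∈ ω}) (forestEv V ∩ {ω | s(o, y) ∈ ω}) = 0 :=
        fibreCount_eq_zero_of_forall _ _ _ _ fun ω _ hA _ => hA.1.2 (hreach hA.2)
      have heM : s(o, v) ∈ insert s(p, q) M'' := hge ▸ mem_insert _ _
      have hfq : ∀ ω, insert s(p, q) ω ∈ {ω : BondConfig V | s(o, y) ∈ ω} ↔ ω ∈ {ω : BondConfig V | s(o, y) ∈ ω} :=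
        insert_mem_pairEv_iff (hge ▸ hef)
      have huniv : ∀ ω, insert s(p, q) ω ∈ (univ : Set (BondConfig V)) ↔ ω ∈ (univ : Set (BondConfig V)) := fun _ => by simp
      have c1 : fibreCount (insert s(p, q) M'') u₀ (forestEv V ∩ {ω | s(o, v) ∈ ω ∧ s(o, y) ∈ ω})
          (forestEv V ∩ {ω | ¬ (openGraph ω).Reachable p q} ∩ univ) =
          fibreCount M'' (insert s(p, q) u₀) (forestEv V ∩ univ) (forestEv V ∩ {ω | s(o, y) ∈ ω}) := by
        rw [fibreCount_swap, ← fibreCount_forest_sep_of_mem hpq hgM'' hgu huniv hfq]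
        refine fibreCount_congr_fibre _ _ fun ω hω => ?_
        constructor
        · rintro ⟨hA, hB⟩; exact ⟨hA, hB.1, hB.2.2⟩
        · rintro ⟨hA, hB⟩
          exact ⟨hA, hB.1, (mem_symmDiff_iff_not_mem heM).2 fun h => hA.1.2 (hreach h), hB.2⟩
      have c2 : fibreCount (insert s(p, q) M'') u₀ (forestEv V ∩ {ω | s(o, v) ∈ ω})
          (forestEv V ∩ {ω | ¬ (openGraph ω).Reachable p q} ∩ {ω | s(o, y) ∈ ω}) =
          fibreCount M'' (insert s(p, q) u₀) (forestEv V ∩ univ) (forestEv V ∩ {ω | s(o, y) ∈ ω}) := by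
        rw [fibreCount_swap, fibreCount_swap M'', ← fibreCount_forest_sep_of_mem hpq hgM'' hgu hfq huniv]
        refine fibreCount_congr_fibre _ _ fun ω hω => ?_
        constructor
        · rintro ⟨hA, hB⟩; exact ⟨hA, hB.1, mem_univ _⟩
        · rintro ⟨hA, hB⟩
          exact ⟨hA, hB.1, (mem_symmDiff_iff_not_mem heM).2 fun h => hA.1.2 (hreach h)⟩
      simp only [z1, z2, c1, c2, zero_add, le_refl]
    by_cases hgf : s(p, q) = s(o, y)
    · have hreach : ∀ {ω : BondConfig V}, s(o, y) ∈ ω → (openGraph ω).Reachable p q := fun {ω} h =>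
        ((openGraph_adj _ _ _).2 ⟨hgf ▸ h, hpq⟩).reachable
      have z1 : fibreCount (insert s(p, q) M'') u₀
          (forestEv V ∩ {ω | ¬ (openGraph ω).Reachable p q} ∩ {ω | s(o, v) ∈ ω ∧ s(o, y) ∈ ω}) (forestEv V ∩ univ) = 0 :=
        fibreCount_eq_zero_of_forall _ _ _ _ fun ω _ hA _ => hA.1.2 (hreach hA.2.2)
      have z2 : fibreCount (insert s(p, q) M'') u₀ (forestEv V ∩ {ω | s(o, v) ∈ ω})
          (forestEv V ∩ {ω | ¬ (openGraph ω).Reachable p q} ∩ {ω | s(o, y) ∈ ω}) = 0 :=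
        fibreCount_eq_zero_of_forall _ _ _ _ fun ω _ _ hB => hB.1.2 (hreach hB.2)
      have hfM : s(o, y) ∈ insert s(p, q) M'' := hgf ▸ mem_insert _ _
      have heq : ∀ ω, insert s(p, q) ω ∈ {ω : BondConfig V | s(o, v) ∈ ω} ↔ ω ∈ {ω : BondConfig V | s(o, v) ∈ ω} :=
        insert_mem_pairEv_iff (hgf ▸ hef.symm)
      have huniv : ∀ ω, insert s(p, q) ω ∈ (univ : Set (BondConfig V)) ↔ ω ∈ (univ : Set (BondConfig V)) := fun _ => by simp
      have c1 : fibreCount (insert s(p, q) M'') u₀ (forestEv V ∩ {ω | s(o, v) ∈ ω ∧ s(o, y) ∈ ω})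
          (forestEv V ∩ {ω | ¬ (openGraph ω).Reachable p q} ∩ univ) =
          fibreCount M'' (insert s(p, q) u₀) (forestEv V ∩ univ) (forestEv V ∩ {ω | s(o, v) ∈ ω}) := by
        rw [fibreCount_swap, ← fibreCount_forest_sep_of_mem hpq hgM'' hgu huniv heq]
        refine fibreCount_congr_fibre _ _ fun ω hω => ?_
        constructor
        · rintro ⟨hA, hB⟩; exact ⟨hA, hB.1, hB.2.1⟩
        · rintro ⟨hA, hB⟩
          exact ⟨hA, hB.1, hB.2, (mem_symmDiff_iff_not_mem hfM).2 fun h => hA.1.2 (hreach h)⟩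
      have c2 : fibreCount (insert s(p, q) M'') u₀
          (forestEv V ∩ {ω | ¬ (openGraph ω).Reachable p q} ∩ {ω | s(o, v) ∈ ω}) (forestEv V ∩ {ω | s(o, y) ∈ ω}) =
          fibreCount M'' (insert s(p, q) u₀) (forestEv V ∩ univ) (forestEv V ∩ {ω | s(o, v) ∈ ω}) := by
        rw [fibreCount_swap M'', ← fibreCount_forest_sep_of_mem hpq hgM'' hgu heq huniv]
        refine fibreCount_congr_fibre _ _ fun ω hω => ?_
        constructor
        · rintro ⟨hA, hB⟩; exact ⟨hA, hB.1, mem_univ _⟩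
        · rintro ⟨hA, hB⟩
          exact ⟨hA, hB.1, (mem_symmDiff_iff_not_mem hfM).2 fun h => hA.1.2 (hreach h)⟩
      simp only [z1, z2, c1, c2, zero_add, add_zero, le_refl]
    have hbl : ∀ ω, insert s(p, q) ω ∈ {ω : BondConfig V | s(o, v) ∈ ω ∧ s(o, y) ∈ ω} ↔
        ω ∈ {ω : BondConfig V | s(o, v) ∈ ω ∧ s(o, y) ∈ ω} := insert_mem_pairEv₂_iff hge hgf
    have hble : ∀ ω, insert s(p, q) ω ∈ {ω : BondConfig V | s(o, v) ∈ ω} ↔ ω ∈ {ω : BondConfig V | s(o, v) ∈ ω} :=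
      insert_mem_pairEv_iff hge
    have hblf : ∀ ω, insert s(p, q) ω ∈ {ω : BondConfig V | s(o, y) ∈ ω} ↔ ω ∈ {ω : BondConfig V | s(o, y) ∈ ω} :=
      insert_mem_pairEv_iff hgf
    have huniv : ∀ ω, insert s(p, q) ω ∈ (univ : Set (BondConfig V)) ↔ ω ∈ (univ : Set (BondConfig V)) := fun _ => by simp
    have c1 := fibreCount_forest_sep_of_mem hpq hgM'' hgu hbl huniv
    have c2 : fibreCount (insert s(p, q) M'') u₀ (forestEv V ∩ {ω | s(o, v) ∈ ω ∧ s(o, y) ∈ ω})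
        (forestEv V ∩ {ω | ¬ (openGraph ω).Reachable p q} ∩ univ) =
        fibreCount M'' (insert s(p, q) u₀) (forestEv V ∩ {ω | s(o, v) ∈ ω ∧ s(o, y) ∈ ω}) (forestEv V ∩ univ) := by
      rw [fibreCount_swap, fibreCount_forest_sep_of_mem hpq hgM'' hgu huniv hbl, fibreCount_swap]
    have c3 := fibreCount_forest_sep_of_mem hpq hgM'' hgu hble hblf
    have c4 : fibreCount (insert s(p, q) M'') u₀ (forestEv V ∩ {ω | s(o, v) ∈ ω})
        (forestEv V ∩ {ω | ¬ (openGraph ω).Reachable p q} ∩ {ω | s(o, y) ∈ ω}) =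
        fibreCount M'' (insert s(p, q) u₀) (forestEv V ∩ {ω | s(o, v) ∈ ω}) (forestEv V ∩ {ω | s(o, y) ∈ ω}) := by
      rw [fibreCount_swap, fibreCount_forest_sep_of_mem hpq hgM'' hgu hblf hble, fibreCount_swap]
    have IH' := IH M'' (insert s(p, q) u₀) hd' hT'
    rw [c1, c2, c3, c4, inter_univ]
    omega
  · have hge : s(p, q) ≠ s(o, v) := fun h => hgM (h ▸ he)
    have hgf : s(p, q) ≠ s(o, y) := fun h => hgM (h ▸ hf)
    have hbl : ∀ ω, insert s(p, q) ω ∈ {ω : BondConfig V | s(o, v) ∈ ω ∧ s(o, y) ∈ ω} ↔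
        ω ∈ {ω : BondConfig V | s(o, v) ∈ ω ∧ s(o, y) ∈ ω} := insert_mem_pairEv₂_iff hge hgf
    have hble : ∀ ω, insert s(p, q) ω ∈ {ω : BondConfig V | s(o, v) ∈ ω} ↔ ω ∈ {ω : BondConfig V | s(o, v) ∈ ω} :=
      insert_mem_pairEv_iff hge
    have hblf : ∀ ω, insert s(p, q) ω ∈ {ω : BondConfig V | s(o, y) ∈ ω} ↔ ω ∈ {ω : BondConfig V | s(o, y) ∈ ω} :=
      insert_mem_pairEv_iff hgf
    have huniv : ∀ ω, insert s(p, q) ω ∈ (univ : Set (BondConfig V)) ↔ ω ∈ (univ : Set (BondConfig V)) := fun _ => by simp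
    rw [fibreCount_forest_sep_add_of_notMem hpq hgM hgu hbl huniv, fibreCount_forest_sep_add_of_notMem hpq hgM hgu hble hblf]
    have hd' : Disjoint u₀ (insert s(p, q) M') := Set.disjoint_insert_right.2 ⟨hgu, hd⟩
    have hT' : ∀ g ∈ insert s(p, q) M' ∪ u₀, ∀ w ∈ g, w ∈ T := by
      intro g hg w hw
      rcases hg with hg | hg
      · rcases mem_insert_iff.1 hg with rfl | hg
        · rcases Sym2.mem_iff.1 hw with rfl | rfl
          · exact hp
          · exact hq
        · exact hT g (Or.inl hg) w hw
      · exact hT g (Or.inr hg) w hw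
    have IH' := IH (insert s(p, q) M') u₀ hd' hT'
    rw [inter_univ]
    exact IH'

end PairCell

/-! ### The elimination steps -/

section Steps

variable {M' u₀ : BondConfig V} {T : Finset V} {o v y : V}

/-- **The degree-two step, level-free** (far vertex `z ∉ {o,v,y}` with exactly the two free pairs `za, zb`): the node on the fibre follows
from the node on all fibres inside `T ∌ z` — twice the rest plus the pair cell of `ab`.
[cite: CibulkaHladkyLaCroixWagner2008, Case 2(i) (p. 4)] [cite: Linusson2011, Prop. 2.6] -/
theorem twoCellBound_step_degTwo
    (IH : ∀ (N u : BondConfig V), Disjoint u N → (∀ g ∈ N ∪ u, ∀ w ∈ g, w ∈ T) →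
      fibreCount N u (forestEv V ∩ {ω | s(o, v) ∈ ω ∧ s(o, y) ∈ ω}) (forestEv V) ≤
        fibreCount N u (forestEv V ∩ {ω | s(o, v) ∈ ω}) (forestEv V ∩ {ω | s(o, y) ∈ ω}))
    {z a b : V} (hd : Disjoint u₀ M') (hz : ∀ g ∈ M' ∪ u₀, z ∉ g) (hza : z ≠ a) (hzb : z ≠ b) (hab : a ≠ b)
    (hzo : z ≠ o) (hzv : z ≠ v) (hzy : z ≠ y) (hT : ∀ g ∈ M' ∪ u₀, ∀ w ∈ g, w ∈ T) (ha : a ∈ T) (hb : b ∈ T)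
    (he : s(o, v) ∈ M') (hf : s(o, y) ∈ M') (hvy : v ≠ y) :
    fibreCount (insert s(z, a) (insert s(z, b) M')) u₀ (forestEv V ∩ {ω | s(o, v) ∈ ω ∧ s(o, y) ∈ ω}) (forestEv V) ≤
      fibreCount (insert s(z, a) (insert s(z, b) M')) u₀ (forestEv V ∩ {ω | s(o, v) ∈ ω}) (forestEv V ∩ {ω | s(o, y) ∈ ω}) := by
  have hPa := insert_mem_pairEv₂_iff (mk_ne_of_far (a := a) hzo hzv) (mk_ne_of_far (a := a) hzo hzy)
  have hPb := insert_mem_pairEv₂_iff (mk_ne_of_far (a := b) hzo hzv) (mk_ne_of_far (a := b) hzo hzy)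
  have hEa := insert_mem_pairEv_iff (mk_ne_of_far (a := a) hzo hzv)
  have hEb := insert_mem_pairEv_iff (mk_ne_of_far (a := b) hzo hzv)
  have hFa := insert_mem_pairEv_iff (mk_ne_of_far (a := a) hzo hzy)
  have hFb := insert_mem_pairEv_iff (mk_ne_of_far (a := b) hzo hzy)
  have hU : ∀ x : V, ∀ ω, insert s(z, x) ω ∈ (univ : Set (BondConfig V)) ↔ ω ∈ (univ : Set (BondConfig V)) := fun _ _ => by simp
  have hb0 : fibreCount (insert s(z, a) (insert s(z, b) M')) u₀ (forestEv V ∩ {ω | s(o, v) ∈ ω ∧ s(o, y) ∈ ω}) (forestEv V) =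
      fibreCount (insert s(z, a) (insert s(z, b) M')) u₀ (forestEv V ∩ {ω | s(o, v) ∈ ω ∧ s(o, y) ∈ ω}) (forestEv V ∩ univ) := by
    rw [inter_univ]
  rw [hb0, fibreCount_forest_degTwo_decomp hz hza hzb hab hPa hPb (hU a) (hU b),
    fibreCount_forest_degTwo_decomp hz hza hzb hab hEa hEb hFa hFb]
  have IH' := IH M' u₀ hd hT
  have c1 := pairCell_le IH hd hT he hf hvy ha hb hab
  simp only [inter_univ] at c1 ⊢
  omega

/-- **The degree-three (claw) step under H1′**: for a vertex `z ∉ {o,v,y}` with exactly the three free pairs `za, zb, zc` and `o ∉ {a,b,c}`,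
the node on the fibre follows from `TwoCellBoundOn V` and the node on all fibres inside `T ∌ z` (the two remaining pair cells).
[cite: CibulkaHladkyLaCroixWagner2008, Case 3, Table 1 (p. 5)] [cite: SempleWelsh2008, Conj. 1.1 (p. 2)] [cite: Linusson2011, Prop. 2.6] -/
theorem twoCellBound_step_claw (hH : TwoCellBoundOn V)
    (IH : ∀ (N u : BondConfig V), Disjoint u N → (∀ g ∈ N ∪ u, ∀ w ∈ g, w ∈ T) →
      fibreCount N u (forestEv V ∩ {ω | s(o, v) ∈ ω ∧ s(o, y) ∈ ω}) (forestEv V) ≤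
        fibreCount N u (forestEv V ∩ {ω | s(o, v) ∈ ω}) (forestEv V ∩ {ω | s(o, y) ∈ ω}))
    {z a b c : V} (hd : Disjoint u₀ M') (hz : ∀ g ∈ M' ∪ u₀, z ∉ g) (hza : z ≠ a) (hzb : z ≠ b) (hzc : z ≠ c)
    (hab : a ≠ b) (hac : a ≠ c) (hbc : b ≠ c) (hoa : o ≠ a) (hob : o ≠ b) (hoc : o ≠ c)
    (hzo : z ≠ o) (hzv : z ≠ v) (hzy : z ≠ y) (hT : ∀ g ∈ M' ∪ u₀, ∀ w ∈ g, w ∈ T) (ha : a ∈ T) (hb : b ∈ T) (hc : c ∈ T)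
    (he : s(o, v) ∈ M') (hf : s(o, y) ∈ M') (hvy : v ≠ y) :
    fibreCount (insert s(z, a) (insert s(z, b) (insert s(z, c) M'))) u₀ (forestEv V ∩ {ω | s(o, v) ∈ ω ∧ s(o, y) ∈ ω}) (forestEv V) ≤
      fibreCount (insert s(z, a) (insert s(z, b) (insert s(z, c) M'))) u₀ (forestEv V ∩ {ω | s(o, v) ∈ ω})
        (forestEv V ∩ {ω | s(o, y) ∈ ω}) := by
  have hPa := insert_mem_pairEv₂_iff (mk_ne_of_far (a := a) hzo hzv) (mk_ne_of_far (a := a) hzo hzy)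
  have hPb := insert_mem_pairEv₂_iff (mk_ne_of_far (a := b) hzo hzv) (mk_ne_of_far (a := b) hzo hzy)
  have hPc := insert_mem_pairEv₂_iff (mk_ne_of_far (a := c) hzo hzv) (mk_ne_of_far (a := c) hzo hzy)
  have hEa := insert_mem_pairEv_iff (mk_ne_of_far (a := a) hzo hzv)
  have hEb := insert_mem_pairEv_iff (mk_ne_of_far (a := b) hzo hzv)
  have hEc := insert_mem_pairEv_iff (mk_ne_of_far (a := c) hzo hzv)
  have hFa := insert_mem_pairEv_iff (mk_ne_of_far (a := a) hzo hzy)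
  have hFb := insert_mem_pairEv_iff (mk_ne_of_far (a := b) hzo hzy)
  have hFc := insert_mem_pairEv_iff (mk_ne_of_far (a := c) hzo hzy)
  have hU : ∀ x : V, ∀ ω, insert s(z, x) ω ∈ (univ : Set (BondConfig V)) ↔ ω ∈ (univ : Set (BondConfig V)) := fun _ _ => by simp
  have hb0 : fibreCount (insert s(z, a) (insert s(z, b) (insert s(z, c) M'))) u₀ (forestEv V ∩ {ω | s(o, v) ∈ ω ∧ s(o, y) ∈ ω})
      (forestEv V) = fibreCount (insert s(z, a) (insert s(z, b) (insert s(z, c) M'))) u₀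
      (forestEv V ∩ {ω | s(o, v) ∈ ω ∧ s(o, y) ∈ ω}) (forestEv V ∩ univ) := by rw [inter_univ]
  rw [hb0, fibreCount_forest_claw_decomp hz hza hzb hzc hab hac hbc hPa hPb hPc (hU a) (hU b) (hU c),
    fibreCount_forest_claw_decomp hz hza hzb hzc hab hac hbc hEa hEb hEc hFa hFb hFc]
  have cab := pairCell_le IH hd hT he hf hvy ha hb hab
  have cac := pairCell_le IH hd hT he hf hvy ha hc hac
  have cbc := pairCell_le IH hd hT he hf hvy hb hc hbc
  have key := hH M' u₀ o v y z a b c hd hvy he hf hz hzo hzv hzy hza hzb hzc hab hac hbc hoa hob hoc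
  simp only [TwoCellIneq, sep₃Ev, sep₂Ev] at key
  rcases key with h | h | h <;> omega

end Steps

end FK
end Summit.CriticalPhenomena.PercolationContinuityZ3.Theorems

end
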